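import Summits.HodgeConjecture.HodgeConjecture.Theorems.HeckePrymWeilWeilTwelvefoldsSqrtMinus7AimedFrameLemmas
import Summits.HodgeConjecture.HodgeConjecture.Theorems.HeckePrymWeilWeilTwelvefoldsSqrtMinus7SymmetricSegre
import Literature.AlgebraicGeometry.Motives.RationalDegreeOneModelWeilType
import Literature.AlgebraicGeometry.Motives.HyperbolicWeilTypeProduct
import Literature.AlgebraicGeometry.Motives.AbelianVarietyCohomologyExteriorH1
import Literature.AlgebraicGeometry.HodgeTheory.AbelianVarietyEndomorphismsHOne
import HarnessLib

/-!
# Crux `HodgeAbelianVarieties` (stmt-HodgeConjecture-1333), line `prym-canonical-z3-split-seeds` — stub `stub_descend`, part III: rational models and the `K`-symmetric weighted Segre embedding, every `d`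

Registered helper `stub_descend_symmetricSegreEmbedding` of the stub `stub_descend`, third of the files
discharging the partner-surface fact `exists_weilTypeSurface_prod_isHyperbolicWeilType_all` (parts I–II:
`…StubDescendPrymMultiplicity`, `…StubDescendPrymSignature`). Two groups of lemmas of the sibling route
`HeckePrymWeil` (line `amnesic-secant-sheaves-split-fourteenfolds`, files
`Theorems/HeckePrymWeilWeilTwelvefoldsSqrtMinus7{AimedFrameLemmas,SymmetricSegre}`, written for `d = 7`)
re-proved with the scalar `7` replaced by an arbitrary `d ≥ 1`:

* the two RATIONAL DEGREE-ONE MODELS fed to `exists_isotropic_blockVectors'` and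
  `Motives.isHyperbolicWeilType_prod_of_rationalModels` (B. van Geemen, LNM 1594, 4.9, Lemma 5.2 (2),
  5.3): `afD_weilModel` (the model of a `K`-symmetrically polarised Weil pair is of Weil type,
  alternating, `M_A² = -d`, on `4n` vectors) and `afD_partnerModel` (the binary model of an elliptic
  curve with `φ ≫ φ = -d`: `M² = -d`, Gram matrix `!![0, 1; -1, 0] · η₀`, `(±φ)^* = ± M`, and the
  `K`-symmetry `(φ, -φ)^*(pr₁^*(c₁η₀) + pr₂^*(c₂η₀)) = d · (…)`), plus `afD_product_symm`;
* the `K`-SYMMETRIC WEIGHTED SEGRE EMBEDDING of `A × (E × E)` (E. Markman, arXiv:2509.23403 §11.5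
  Step 2; R. Hartshorne, Algebraic Geometry II Ex. 5.11–5.12): `stub_descend_symmetricSegreEmbedding` —
  a projective embedding `e_A` of `A` with `K`-symmetric hyperplane class `φ^* h_A = d h_A` (graph of
  `φ` into `s_{d-1}(e₀) × e₀`, class `d h₀ + φ^* h₀`, `φ^*φ^* = (-[d])^* = d²` on `H² = H¹ ⌣ H¹`) and, for all weights `m₁, m₂ ≥ 1`, the Segre embedding `e` of `e_A`
  with `s_{m₁-1}(e_E) × s_{m₂-1}(e_E)` and a rational generator `a` with
  `e^* a = pr_A^* h_A + s · pr_{E×E}^*(m₁ pr₁^*η + m₂ pr₂^*η)`.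

The `d`-free helpers (`af_mulVec_mulVec_of_frame`, `af_weil_mulVec_of_entries`, `af_GE_antisymm`,
`af_map_eq_sum_ratCast`, `af_map_neg_eq_sum_ratCast`, `af_gram_curve`, `af_top_curve`; Segre additivity
`exists_segreHyperplaneClasses`, `map_segrePow_of_additive`, the closed-immersion and functoriality
bookkeeping) are imported from the sibling files. No named fact is taken.
-/

-- every declaration of this problem lives in `Summit.HodgeConjecture.HodgeConjecture.…` (single-problem summit)
set_option linter.dupNamespace false

noncomputable section

open CategoryTheory AlgebraicGeometry MonoidalCategory CartesianMonoidalCategory Complex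
open Literature.AlgebraicGeometry Literature.AlgebraicGeometry.Motives
  Literature.AlgebraicGeometry.HodgeTheory Literature.AlgebraicTopology.SingularHomology
open Literature.Geometry.Kaehler
open Summit.HodgeConjecture.HodgeConjecture.Theorems.WeilTwelvefoldsSqrtMinus7.AmnesicSecantSheaves

namespace Summit.HodgeConjecture.HodgeConjecture.Cruxes.HodgeAbelianVarieties.PrymCanonicalZ3SplitSeeds.Stubs.Descend

/-! ### The curve `E` and the partner surface `E × E`, every `d` -/

section Partner

variable {E : AbelianVariety ℂ} {d : ℕ}

/-- `(-φ) ≫ (-φ) = φ ≫ φ = -d` (van Geemen's conjugate action `ῑ`). [cite: vanGeemen1994HodgeAV, Lemma 5.3] -/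
theorem afD_neg_comp_neg {A : AbelianVariety ℂ} {φ : A ⟶ A} (hφ : φ ≫ φ = -(d • 𝟙 A)) :
    (-φ) ≫ (-φ) = -(d • 𝟙 A) := by
  rw [Preadditive.neg_comp, Preadditive.comp_neg, neg_neg, hφ]

/-- **An isogeny `φ` with `φ ≫ φ = -d` of an elliptic curve acts on `H²(E(ℂ); ℂ)` by `d`** (its degree;
`Motives.map_top_eq_pow_smul` with `H• = ⋀• H¹`). [cite: LangeBirkenhake1992, Prop. 1.1.9 and Lemma 1.1.17] -/
theorem afD_map_two_curve (hE : E.dim = 1) (hd : 0 < d) {φ : E ⟶ E} (hφ : φ ≫ φ = -(d • 𝟙 E))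
    (η : complexBetti E.X 2) : complexBetti.map φ.hom.hom.hom 2 η = (d : ℂ) • η := by
  have hE' : E.dim = 0 + 1 := hE
  have h := map_top_eq_pow_smul (j := 0) hE' (abelianVarietyCohomologyExteriorH1_holds.finrank_one E)
    (abelianVarietyCohomologyExteriorH1_holds.span_range_cupPowOne E (2 + 2 * 0)) hd hφ η
  simpa using h

/-- **`M² = -d` on coordinate vectors** for the integer model matrix `M` of `φ^*` on a basis of
`H¹(E(ℂ); ℂ)`, `φ ≫ φ = -d`. [cite: vanGeemen1994HodgeAV, 4.9 and Lemma 5.3] -/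
theorem afD_ME_mulVec_mulVec {φ : E ⟶ E} (hφ : φ ≫ φ = -(d • 𝟙 E)) (x : Fin 2 → complexBetti E.X 1)
    (hxi : LinearIndependent ℂ x) (M : Matrix (Fin 2) (Fin 2) ℤ)
    (hM : ∀ i, complexBetti.map φ.hom.hom.hom 1 (x i) = ∑ j, ((M j i : ℤ) : ℂ) • x j) (v : Fin 2 → ℚ) :
    (M.map (Int.cast : ℤ → ℚ)).mulVec ((M.map (Int.cast : ℤ → ℚ)).mulVec v) = -((d : ℚ) • v) := by
  have h := af_mulVec_mulVec_of_frame (complexBetti.map φ.hom.hom.hom 1).hom x hxi (M.map (Int.cast : ℤ → ℚ))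
    (fun i => af_map_eq_sum_ratCast φ x M hM i) (-(d : ℚ)) (fun i => ?_) v
  · rw [h, neg_smul]
  · have h2 := complexBetti_map_map_one_of_comp_self hφ (x i)
    change complexBetti.map φ.hom.hom.hom 1 (complexBetti.map φ.hom.hom.hom 1 (x i)) = _
    rw [h2]
    push_cast
    rw [neg_smul]

/-- **`ψ = (φ, -φ)` multiplies the weighted product class of `E × E` by `d`**:
`ψ^*(pr₁^*(c₁ η) + pr₂^*(c₂ η)) = d · (pr₁^*(c₁ η) + pr₂^*(c₂ η))` (`(±φ)^* η = d η` on `H²(E)`).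
[cite: vanGeemen1994HodgeAV, Lemma 5.3] -/
theorem afD_partner_symm (hE : E.dim = 1) (hd : 0 < d) {φ : E ⟶ E} (hφ : φ ≫ φ = -(d • 𝟙 E))
    (η : complexBetti E.X 2) (c₁ c₂ : ℂ) :
    complexBetti.map (AbelianVariety.prodLift (AbelianVariety.fst E E ≫ φ)
        (AbelianVariety.snd E E ≫ (-φ))).hom.hom.hom 2
      (complexBetti.map (AbelianVariety.fst E E).hom.hom.hom 2 (c₁ • η) +
        complexBetti.map (AbelianVariety.snd E E).hom.hom.hom 2 (c₂ • η)) =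
    (d : ℂ) • (complexBetti.map (AbelianVariety.fst E E).hom.hom.hom 2 (c₁ • η) +
        complexBetti.map (AbelianVariety.snd E E).hom.hom.hom 2 (c₂ • η)) := by
  have h1 : complexBetti.map φ.hom.hom.hom 2 (c₁ • η) = (d : ℂ) • (c₁ • η) := by
    rw [map_smul, afD_map_two_curve hE hd hφ, smul_comm]
  have h2 : complexBetti.map (-φ).hom.hom.hom 2 (c₂ • η) = (d : ℂ) • (c₂ • η) := by
    rw [map_smul, afD_map_two_curve hE hd (afD_neg_comp_neg hφ), smul_comm]
  rw [map_add, Motives.map_prodLift_map_fst, Motives.map_prodLift_map_snd, h1, h2]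
  simp only [map_smul, smul_add]

end Partner

/-! ### The two packaged models, every `d` -/

/-- **The rational degree-one model of a `K`-symmetrically polarised Weil pair is of Weil type,
alternating, with `M_A² = -d`, on `4n` vectors** (van Geemen 4.9 and Lemma 5.2 (2); `b₁ = 2 dim A`).
[cite: vanGeemen1994HodgeAV, 4.9 and Lemma 5.2 (2)] [cite: LangeBirkenhake1992, Prop. 1.1.9 and Lemma 1.1.17] -/
theorem afD_weilModel {n d : ℕ} {A : AbelianVariety ℂ} {φ : A ⟶ A} (hn : 1 ≤ n) (hd : 0 < d)
    (hA : A.dim = 2 * n) (hφ : φ ≫ φ = -(d • 𝟙 A)) {h : complexBetti A.X 2}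
    (hh : complexBetti.map φ.hom.hom.hom 2 h = (d : ℂ) • h) {r : ℕ} {u : Fin r → complexBetti A.X 1}
    (hui : LinearIndependent ℂ u) (hus : Submodule.span ℂ (Set.range u) = ⊤) {MA : Matrix (Fin r) (Fin r) ℚ}
    (hMA : ∀ i, complexBetti.map φ.hom.hom.hom 1 (u i) = ∑ j, ((MA j i : ℚ) : ℂ) • u j)
    {ω : complexBetti A.X (2 + 2 * (2 * n - 1))} (hω0 : ω ≠ 0) {GA : Matrix (Fin r) (Fin r) ℚ}
    (hGA : ∀ i j, polarizationPairingOne A.X h (2 * n - 1) (u i) (u j) = ((GA i j : ℚ) : ℂ) • ω) :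
    (∀ v w : Fin r → ℚ, MA.mulVec v ⬝ᵥ GA.mulVec (MA.mulVec w) = d * (v ⬝ᵥ GA.mulVec w)) ∧
    (∀ v w : Fin r → ℚ, w ⬝ᵥ GA.mulVec v = -(v ⬝ᵥ GA.mulVec w)) ∧
    (∀ v : Fin r → ℚ, MA.mulVec (MA.mulVec v) = -((d : ℚ) • v)) ∧
    Fintype.card (Fin r) = 4 * n := by
  have hA' : A.dim = (2 * n - 1) + 1 := by rw [hA]; omega
  refine ⟨fun v w => ?_, af_antisymm_mulVec_of_entries GA (gram_antisymm _ _ u hω0 GA hGA), fun v => ?_, ?_⟩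
  · exact af_weil_mulVec_of_entries MA GA (d : ℚ) (gram_map_eq_mul_gram hA'
      (abelianVarietyCohomologyExteriorH1_holds.finrank_one A)
      (abelianVarietyCohomologyExteriorH1_holds.span_range_cupPowOne A (2 + 2 * (2 * n - 1)))
      hd hφ hh u MA hMA hω0 GA hGA) v w
  · have e := af_mulVec_mulVec_of_frame (complexBetti.map φ.hom.hom.hom 1).hom u hui MA hMA (-(d : ℚ))
      (fun i => ?_) v
    · rw [e, neg_smul]
    · have h2 := complexBetti_map_map_one_of_comp_self hφ (u i)
      change complexBetti.map φ.hom.hom.hom 1 (complexBetti.map φ.hom.hom.hom 1 (u i)) = _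
      rw [h2]
      push_cast
      rw [neg_smul]
  · have h1 := finrank_span_eq_card (R := ℂ) hui
    rw [hus, finrank_top, abelianVarietyCohomologyExteriorH1_holds.finrank_one A, hA] at h1
    omega

/-- **The binary partner model of the CM curve, every `d`.** For an elliptic curve `E` with
`φ ≫ φ = -d` and an integer model `(x, M)` of `φ^*` on a basis `x₀, x₁` of `H¹(E(ℂ); ℂ)`: `M² = -d`
over `ℚ`; the Gram matrix of `Q_{h,0}(xᵢ, xⱼ) = xᵢ ⌣ xⱼ` is `!![0, 1; -1, 0] · η₀`, `η₀ = x₀ ⌣ x₁`,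
alternating; `(±φ)^*` have matrices `±M`; `L⁰_{cη₀}(cη₀) = c η₀`; and `ψ = (φ, -φ)` multiplies the
weighted product class `pr₁^*(c₁ η₀) + pr₂^*(c₂ η₀)` of `E × E` by `d`.
[cite: vanGeemen1994HodgeAV, Lemma 5.2 (2) and 5.3] [cite: HatcherAT2002, Thm. 3.11] -/
theorem afD_partnerModel {d : ℕ} {E : AbelianVariety ℂ} {φ : E ⟶ E} (hE : E.dim = 1) (hd : 0 < d)
    (hφ : φ ≫ φ = -(d • 𝟙 E))
    (x : Fin 2 → complexBetti E.X 1) (hxi : LinearIndependent ℂ x) (M : Matrix (Fin 2) (Fin 2) ℤ)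
    (hM : ∀ i, complexBetti.map φ.hom.hom.hom 1 (x i) = ∑ j, ((M j i : ℤ) : ℂ) • x j) :
    (∀ v : Fin 2 → ℚ, (M.map (Int.cast : ℤ → ℚ)).mulVec ((M.map (Int.cast : ℤ → ℚ)).mulVec v) = -((d : ℚ) • v)) ∧
    (∀ a b : Fin 2 → ℚ, b ⬝ᵥ (!![0, 1; -1, 0] : Matrix (Fin 2) (Fin 2) ℚ).mulVec a =
      -(a ⬝ᵥ (!![0, 1; -1, 0] : Matrix (Fin 2) (Fin 2) ℚ).mulVec b)) ∧
    (∀ i, complexBetti.map φ.hom.hom.hom 1 (x i) = ∑ j, (((M.map (Int.cast : ℤ → ℚ)) j i : ℚ) : ℂ) • x j) ∧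
    (∀ i, complexBetti.map (-φ).hom.hom.hom 1 (x i) =
      ∑ j, (((-(M.map (Int.cast : ℤ → ℚ))) j i : ℚ) : ℂ) • x j) ∧
    (∀ (h : complexBetti E.X 2) (i j : Fin 2), polarizationPairingOne E.X h 0 (x i) (x j) =
      (((!![0, 1; -1, 0] : Matrix (Fin 2) (Fin 2) ℚ) i j : ℚ) : ℂ) • cupProduct (rfl : 1 + 1 = 2) (x 0) (x 1)) ∧
    (∀ c : ℚ, lefschetzPow (((c : ℚ) : ℂ) • cupProduct (rfl : 1 + 1 = 2) (x 0) (x 1)) 0 2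
        (((c : ℚ) : ℂ) • cupProduct (rfl : 1 + 1 = 2) (x 0) (x 1)) =
      ((c : ℚ) : ℂ) • cupProduct (rfl : 1 + 1 = 2) (x 0) (x 1)) ∧
    (∀ c₁ c₂ : ℂ, complexBetti.map (AbelianVariety.prodLift (AbelianVariety.fst E E ≫ φ)
        (AbelianVariety.snd E E ≫ (-φ))).hom.hom.hom 2
        (complexBetti.map (AbelianVariety.fst E E).hom.hom.hom 2 (c₁ • cupProduct (rfl : 1 + 1 = 2) (x 0) (x 1)) +
          complexBetti.map (AbelianVariety.snd E E).hom.hom.hom 2 (c₂ • cupProduct (rfl : 1 + 1 = 2) (x 0) (x 1))) =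
      (d : ℂ) • (complexBetti.map (AbelianVariety.fst E E).hom.hom.hom 2 (c₁ • cupProduct (rfl : 1 + 1 = 2) (x 0) (x 1)) +
          complexBetti.map (AbelianVariety.snd E E).hom.hom.hom 2 (c₂ • cupProduct (rfl : 1 + 1 = 2) (x 0) (x 1)))) :=
  ⟨afD_ME_mulVec_mulVec hφ x hxi M hM, af_GE_antisymm, af_map_eq_sum_ratCast φ x M hM,
    af_map_neg_eq_sum_ratCast φ x M hM, af_gram_curve x, af_top_curve _, afD_partner_symm hE hd hφ _⟩

/-- **The `K`-symmetrisation of the product class is multiplication by `d`**: for `K`-symmetric classes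
`φ_A^* h_A = d h_A`, `ψ^* h_B = d h_B` on the factors,
`(φ_A × ψ)^*(pr_A^* h_A + pr_B^* h_B) = d · (pr_A^* h_A + pr_B^* h_B)`. [cite: Markman2025SurveySecant, §11.5 Step 2] -/
theorem afD_product_symm {d : ℕ} {A B : AbelianVariety ℂ} (φ : A ⟶ A) (ψ : B ⟶ B) {hA2 : complexBetti A.X 2}
    {hB2 : complexBetti B.X 2} (hA : complexBetti.map φ.hom.hom.hom 2 hA2 = (d : ℂ) • hA2)
    (hB : complexBetti.map ψ.hom.hom.hom 2 hB2 = (d : ℂ) • hB2) :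
    complexBetti.map (AbelianVariety.prodLift (AbelianVariety.fst A B ≫ φ) (AbelianVariety.snd A B ≫ ψ)).hom.hom.hom 2
      (complexBetti.map (AbelianVariety.fst A B).hom.hom.hom 2 hA2 +
        complexBetti.map (AbelianVariety.snd A B).hom.hom.hom 2 hB2) =
    (d : ℂ) • (complexBetti.map (AbelianVariety.fst A B).hom.hom.hom 2 hA2 +
        complexBetti.map (AbelianVariety.snd A B).hom.hom.hom 2 hB2) := by
  rw [map_add, Motives.map_prodLift_map_fst, Motives.map_prodLift_map_snd, hA, hB]
  simp only [map_smul, smul_add]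

/-! ### The registered helper: the `K`-symmetric weighted Segre embedding, every `d ≥ 1` -/

/-- **The `K`-symmetric weighted Segre embedding of `A × (E × E)`, every `d ≥ 1`** (registered helper
`stub_descend_symmetricSegreEmbedding` of stmt-HodgeConjecture-1333). For `(A, φ)` with
`φ ≫ φ = -(d • 𝟙 A)`, a complex elliptic curve `E` and a non-zero rational `η ∈ H²(E(ℂ); ℂ)`: a
projective embedding `e_A` of `A` and a non-zero rational `a_A ∈ H²(ℙᴺ(ℂ))` whose hyperplane class
`h_A = e_A^* a_A` is `K`-symmetric, `φ^* h_A = d h_A` (the Segre embedding of the graph of `φ` in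
`s_{d-1}(e₀) × e₀`, class `d h₀ + φ^*h₀`, with `φ^*φ^* = (-[d])^* = d²` on `H²`), and a rational `s` such
that for all weights `m₁, m₂ ≥ 1` the Segre embedding of `e_A` with `s_{m₁-1}(e_E) × s_{m₂-1}(e_E)`
has hyperplane class `pr_A^* h_A + s · pr_{E×E}^*(m₁ pr₁^* η + m₂ pr₂^* η)` (Segre additivity on `H²`,
`exists_segreHyperplaneClasses`; `s_k^* g = (k+1) g`; `e_E^* g = s η` on the line `H²(E(ℂ); ℂ)`).
[cite: Hartshorne1977, II Ex. 5.11 and Ex. 5.12] [cite: Markman2025SurveySecant, §11.5 Step 2] -/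
theorem stub_descend_symmetricSegreEmbedding :
    ∀ (d : ℕ), 0 < d → ∀ (A : AbelianVariety ℂ) (φ : A ⟶ A), φ ≫ φ = -(d • 𝟙 A) →
    ∀ (E : AbelianVariety ℂ), E.dim = 1 →
    ∀ (η : complexBetti E.X 2), IsRationalClass η → η ≠ 0 →
    ∃ (eA : ProjectiveEmbedding A.X) (aA : complexBetti (projectiveSpace eA.n ℂ) 2) (s : ℚ),
      IsRationalClass aA ∧ aA ≠ 0 ∧
      complexBetti.map φ.hom.hom.hom 2 (complexBetti.map eA.ι 2 aA) = (d : ℂ) • complexBetti.map eA.ι 2 aA ∧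
      ∀ (m₁ m₂ : ℕ), 0 < m₁ → 0 < m₂ →
        ∃ (e : ProjectiveEmbedding (A.prod (E.prod E)).X) (a : complexBetti (projectiveSpace e.n ℂ) 2),
          IsRationalClass a ∧ a ≠ 0 ∧
          complexBetti.map e.ι 2 a =
            complexBetti.map (AbelianVariety.fst A (E.prod E)).hom.hom.hom 2 (complexBetti.map eA.ι 2 aA) +
            ((s : ℚ) : ℂ) • complexBetti.map (AbelianVariety.snd A (E.prod E)).hom.hom.hom 2
              (((m₁ : ℕ) : ℂ) • complexBetti.map (AbelianVariety.fst E E).hom.hom.hom 2 η +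
                ((m₂ : ℕ) : ℂ) • complexBetti.map (AbelianVariety.snd E E).hom.hom.hom 2 η) := by
  intro d hd A φ hφ E hE η hη hη0
  -- `(-(d • 𝟙))^* = d²` on `H²(A(ℂ); ℂ)`: `-d` on `H¹`, and `H²` is spanned by cup products
  have hneg2 : ∀ y : complexBetti A.X 2, complexBetti.map (-(d • 𝟙 A)).hom.hom.hom 2 y = ((d : ℂ) ^ 2) • y := by
    have hφ₀ : -(d • 𝟙 A) = (-(d : ℤ)) • 𝟙 A + (0 : ℤ) • 𝟙 A := by
      rw [zero_smul, add_zero, neg_smul, natCast_zsmul]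
    have hone : ∀ c : complexBetti A.X 1, complexBetti.map (-(d • 𝟙 A)).hom.hom.hom 1 c = (-(d : ℂ)) • c := by
      intro c
      rw [hφ₀, complexBetti_map_zsmul_id_add_zsmul_one]
      simp
    have key : ∀ v : Fin 2 → complexBetti A.X 1,
        complexBetti.map (-(d • 𝟙 A)).hom.hom.hom 2 (cupPowOne ℂ (ComplexPoints A.X) 2 v) =
          ((d : ℂ) ^ 2) • cupPowOne ℂ (ComplexPoints A.X) 2 v := by
      intro v
      rw [complexBetti_map_cupPowOne]
      have hv : (fun i ↦ complexBetti.map (-(d • 𝟙 A)).hom.hom.hom 1 (v i)) = fun i ↦ (-(d : ℂ)) • v i :=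
        funext fun i ↦ hone (v i)
      rw [hv, MultilinearMap.map_smul_univ, Finset.prod_const, Finset.card_univ, Fintype.card_fin, neg_pow]
      norm_num
    have hspan := (abelianVarietyCohomologyExteriorH1_holds.hasExteriorCohomologyH1 A).span_range_cupPowOne 2
    intro y
    have hy : y ∈ Submodule.span ℂ (Set.range (cupPowOne ℂ (ComplexPoints A.X) 2)) := by
      rw [hspan]; exact Submodule.mem_top
    induction hy using Submodule.span_induction with
    | mem x hx =>
      obtain ⟨v, rfl⟩ := hx
      exact key v
    | zero => rw [map_zero, smul_zero]
    | add a b _ _ ha hb => rw [map_add, smul_add, ha, hb]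
    | smul r a _ ha => rw [map_smul, ha, smul_comm]
  obtain ⟨d', rfl⟩ : ∃ d', d = d' + 1 := ⟨d - 1, by omega⟩
  obtain ⟨g, hgr, hgnz, hgσ⟩ := exists_segreHyperplaneClasses
  obtain ⟨N, e₀, hN, he₀⟩ := exists_closedImmersion_projectiveSpace_pos A
  obtain ⟨M, f₀, hM, hf₀⟩ := exists_closedImmersion_projectiveSpace_pos E
  haveI := he₀
  haveI := hf₀
  -- the `K`-symmetric embedding of `A`: graph of `φ`, then `s_{d'}(e₀) × e₀`, then Segre
  obtain ⟨ιA, hιA⟩ : ∃ ι : A.X ⟶ projectiveSpace (ProjectiveSpace.segrePowDim N d' * N + ProjectiveSpace.segrePowDim N d' + N) ℂ,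
      ι = CartesianMonoidalCategory.lift (𝟙 A.X) φ.hom.hom.hom ≫
        ((e₀ ≫ ProjectiveSpace.segrePow N ℂ d') ⊗ₘ e₀) ≫ segreEmbedding (ProjectiveSpace.segrePowDim N d') N ℂ :=
    ⟨_, rfl⟩
  haveI := isClosedImmersion_segrePow_left N d'
  haveI : IsClosedImmersion (e₀ ≫ ProjectiveSpace.segrePow N ℂ d').left := by
    change IsClosedImmersion (e₀.left ≫ (ProjectiveSpace.segrePow N ℂ d').left); infer_instance
  haveI := isClosedImmersion_tensorHom_left (e₀ ≫ ProjectiveSpace.segrePow N ℂ d') e₀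
  haveI := isClosedImmersion_lift_id_left (X := A.X) (Y := A.X) φ.hom.hom.hom
  haveI hιAci : IsClosedImmersion ιA.left := by
    rw [hιA]
    change IsClosedImmersion ((CartesianMonoidalCategory.lift (𝟙 A.X) φ.hom.hom.hom).left ≫
      (((e₀ ≫ ProjectiveSpace.segrePow N ℂ d') ⊗ₘ e₀).left ≫
        (segreEmbedding (ProjectiveSpace.segrePowDim N d') N ℂ).left))
    infer_instance
  let eA : ProjectiveEmbedding A.X := ⟨_, ιA, hιAci⟩
  obtain ⟨h₀, hh₀⟩ : ∃ h : complexBetti A.X 2, h = complexBetti.map e₀ 2 (g N) := ⟨_, rfl⟩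
  have hA : complexBetti.map ιA 2 (g (ProjectiveSpace.segrePowDim N d' * N + ProjectiveSpace.segrePowDim N d' + N)) =
      ((d' + 1 : ℕ) : ℂ) • h₀ + complexBetti.map φ.hom.hom.hom 2 h₀ := by
    rw [hιA, map_comp_apply', map_comp_apply', hgσ (ProjectiveSpace.segrePowDim N d') N, map_add, map_add,
      map_tensorHom_map_fst, map_tensorHom_map_snd, map_lift_map_fst, map_lift_map_snd, complexBetti.map_id,
      ModuleCat.id_apply, map_comp_apply', map_segrePow_of_additive g hgσ N d', map_smul, ← hh₀]
  -- the curve: `f₀^* g = s • η`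
  obtain ⟨s, hs⟩ := exists_eq_ratCast_smul_of_curve E hE hη hη0
    ((hgr M).pullback (AlgPoints.mapContinuous (L := ℂ) f₀))
  have hKA : 1 ≤ ProjectiveSpace.segrePowDim N d' * N + ProjectiveSpace.segrePowDim N d' + N :=
    le_trans hN (Nat.le_add_left _ _)
  refine ⟨eA, g _, s, hgr _, hgnz _ hKA, ?_, fun m₁ m₂ hm₁ hm₂ ↦ ?_⟩
  · -- `φ^* h_A = d h_A`
    change complexBetti.map φ.hom.hom.hom 2
        (complexBetti.map ιA 2 (g (ProjectiveSpace.segrePowDim N d' * N + ProjectiveSpace.segrePowDim N d' + N))) =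
      ((d' + 1 : ℕ) : ℂ) •
        complexBetti.map ιA 2 (g (ProjectiveSpace.segrePowDim N d' * N + ProjectiveSpace.segrePowDim N d' + N))
    have hcomp : φ.hom.hom.hom ≫ φ.hom.hom.hom = (φ ≫ φ).hom.hom.hom := rfl
    rw [hA, map_add, map_smul, ← map_comp_apply', hcomp, hφ, hneg2, smul_add, smul_smul,
      add_comm, ← pow_two]
  · -- the weighted Segre embedding of `A × (E × E)`
    obtain ⟨d₁, rfl⟩ : ∃ k, m₁ = k + 1 := ⟨m₁ - 1, by omega⟩
    obtain ⟨d₂, rfl⟩ : ∃ k, m₂ = k + 1 := ⟨m₂ - 1, by omega⟩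
    obtain ⟨ιE, hιE⟩ : ∃ ι : E.X ⊗ E.X ⟶ projectiveSpace (ProjectiveSpace.segrePowDim M d₁ * ProjectiveSpace.segrePowDim M d₂ +
        ProjectiveSpace.segrePowDim M d₁ + ProjectiveSpace.segrePowDim M d₂) ℂ,
        ι = ((f₀ ≫ ProjectiveSpace.segrePow M ℂ d₁) ⊗ₘ (f₀ ≫ ProjectiveSpace.segrePow M ℂ d₂)) ≫
          segreEmbedding (ProjectiveSpace.segrePowDim M d₁) (ProjectiveSpace.segrePowDim M d₂) ℂ := ⟨_, rfl⟩
    haveI := isClosedImmersion_segrePow_left M d₁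
    haveI := isClosedImmersion_segrePow_left M d₂
    haveI : IsClosedImmersion (f₀ ≫ ProjectiveSpace.segrePow M ℂ d₁).left := by
      change IsClosedImmersion (f₀.left ≫ (ProjectiveSpace.segrePow M ℂ d₁).left); infer_instance
    haveI : IsClosedImmersion (f₀ ≫ ProjectiveSpace.segrePow M ℂ d₂).left := by
      change IsClosedImmersion (f₀.left ≫ (ProjectiveSpace.segrePow M ℂ d₂).left); infer_instance
    haveI := isClosedImmersion_tensorHom_left (X := E.X) (Y := E.X) (f₀ ≫ ProjectiveSpace.segrePow M ℂ d₁)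
      (f₀ ≫ ProjectiveSpace.segrePow M ℂ d₂)
    haveI hιEci : IsClosedImmersion ιE.left := by
      rw [hιE]
      change IsClosedImmersion (((f₀ ≫ ProjectiveSpace.segrePow M ℂ d₁) ⊗ₘ (f₀ ≫ ProjectiveSpace.segrePow M ℂ d₂)).left ≫
        (segreEmbedding (ProjectiveSpace.segrePowDim M d₁) (ProjectiveSpace.segrePowDim M d₂) ℂ).left)
      infer_instance
    obtain ⟨ι, hι⟩ : ∃ ι : A.X ⊗ (E.X ⊗ E.X) ⟶ projectiveSpace
        ((ProjectiveSpace.segrePowDim N d' * N + ProjectiveSpace.segrePowDim N d' + N) *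
          (ProjectiveSpace.segrePowDim M d₁ * ProjectiveSpace.segrePowDim M d₂ + ProjectiveSpace.segrePowDim M d₁ +
            ProjectiveSpace.segrePowDim M d₂) +
          (ProjectiveSpace.segrePowDim N d' * N + ProjectiveSpace.segrePowDim N d' + N) +
          (ProjectiveSpace.segrePowDim M d₁ * ProjectiveSpace.segrePowDim M d₂ + ProjectiveSpace.segrePowDim M d₁ +
            ProjectiveSpace.segrePowDim M d₂)) ℂ,
        ι = (ιA ⊗ₘ ιE) ≫ segreEmbedding _ _ ℂ := ⟨_, rfl⟩
    haveI := isClosedImmersion_tensorHom_left (X := A.X) (Y := E.X ⊗ E.X) ιA ιE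
    have hιci : IsClosedImmersion ι.left := by
      rw [hι]
      change IsClosedImmersion ((ιA ⊗ₘ ιE).left ≫ (segreEmbedding _ _ ℂ).left)
      infer_instance
    have hKK : 1 ≤ (ProjectiveSpace.segrePowDim N d' * N + ProjectiveSpace.segrePowDim N d' + N) *
          (ProjectiveSpace.segrePowDim M d₁ * ProjectiveSpace.segrePowDim M d₂ + ProjectiveSpace.segrePowDim M d₁ +
            ProjectiveSpace.segrePowDim M d₂) +
          (ProjectiveSpace.segrePowDim N d' * N + ProjectiveSpace.segrePowDim N d' + N) +
          (ProjectiveSpace.segrePowDim M d₁ * ProjectiveSpace.segrePowDim M d₂ + ProjectiveSpace.segrePowDim M d₁ +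
            ProjectiveSpace.segrePowDim M d₂) :=
      le_trans hKA ((Nat.le_add_left _ _).trans (Nat.le_add_right _ _))
    refine ⟨⟨_, ι, hιci⟩, g _, hgr _, hgnz _ hKK, ?_⟩
    have hEcl : complexBetti.map ιE 2 (g _) =
        ((d₁ + 1 : ℕ) : ℂ) • complexBetti.map (fst E.X E.X) 2 (complexBetti.map f₀ 2 (g M)) +
          ((d₂ + 1 : ℕ) : ℂ) • complexBetti.map (snd E.X E.X) 2 (complexBetti.map f₀ 2 (g M)) := by
      rw [hιE, map_comp_apply', hgσ (ProjectiveSpace.segrePowDim M d₁) (ProjectiveSpace.segrePowDim M d₂), map_add,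
        map_tensorHom_map_fst, map_tensorHom_map_snd, map_comp_apply', map_comp_apply',
        map_segrePow_of_additive g hgσ M d₁, map_segrePow_of_additive g hgσ M d₂]
      simp only [map_smul]
    have final : complexBetti.map ι 2 (g _) =
        complexBetti.map (fst A.X (E.X ⊗ E.X)) 2
            (complexBetti.map ιA 2 (g (ProjectiveSpace.segrePowDim N d' * N + ProjectiveSpace.segrePowDim N d' + N))) +
          ((s : ℚ) : ℂ) • complexBetti.map (snd A.X (E.X ⊗ E.X)) 2
            (((d₁ + 1 : ℕ) : ℂ) • complexBetti.map (fst E.X E.X) 2 η +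
              ((d₂ + 1 : ℕ) : ℂ) • complexBetti.map (snd E.X E.X) 2 η) := by
      rw [hι, map_comp_apply', hgσ, map_add, map_tensorHom_map_fst, map_tensorHom_map_snd, hEcl, hs]
      simp only [map_add, map_smul, smul_add, smul_smul, mul_comm]
    exact final

end Summit.HodgeConjecture.HodgeConjecture.Cruxes.HodgeAbelianVarieties.PrymCanonicalZ3SplitSeeds.Stubs.Descend

end
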